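import Summits.CriticalPhenomena.PercolationContinuityZ3.Theorems.PercNearOneGluingNoHeavyLowerTailFKCSHPhiNonneg
import Summits.CriticalPhenomena.PercolationContinuityZ3.Theorems.PercNearOneGluingNoHeavyLowerTailHullPortTACond
import HarnessLib

/-!
# FK sub-lane: DEFINITIONS for the lockstep-exploration proof of Lemma Φ(b)_FK (`FK.PhiFKMonotone q`, `q ≥ 1`)

Definitions file (`--supports stmt-CriticalPhenomena-4575`), FK sub-lane `prim-bschramm-fk-1` (gen 3) of the post-continuity programme;
builds on p205010 (kernel theorem, internal audit signed; external expert review pending).  No named facts, no sorries; standard axioms.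
Nothing is asserted here; the theorem `FK.phiFKMonotone_of_one_le` lands in `…FKCSHPhiMonotone.lean`.

THE PROOF IN ONE PARAGRAPH.  Write `Θ_w(v) := E_{φ_v}[1{x ↮ Y}(a_w(C_Y) − g(C_x))]` (`φ_v = rcMeasureW v q ∅`, world mean
`a_w(W) = E_{φ_{w−W̄}} g(C_x)`), so that `FK.phiFK w q x Y g K = Θ_w(w − K̄)`.  CLAIM: `v ≤ v'`, `v ≤ w` ⟹ `Θ_w(v') ≤ Θ_w(v)`.  Explore the
cluster of `Y` under `φ_v` and `φ_{v'}` IN LOCKSTEP: revealing a pair `f` open/closed is the parameter update `v[f ↦ 1]` / `v[f ↦ 0]`,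
`E_v = φ_v(f)·E_{v[f↦1]} + (1−φ_v(f))·E_{v[f↦0]}` (Grimmett's Thm (3.7)), and `φ_v(f) ≤ φ_{v'}(f)` for `v ≤ v'` (Thm (3.21)); coupling the
revealed bits through one uniform variable is a nonnegative combination (`FK.lockstep2/3`).  When the smaller cluster `A` is exhausted,
`C_Y = A` a.s. under `φ_v`, the parameters inside `A` are invisible outside (van den Berg–Häggström–Kahn's Lemma 2.3), and one continues
exploring the LARGER cluster together with a fresh WORLD SAMPLE `ζ ~ φ_{w−Ā}` of the smaller one; when that is exhausted too, everything
left is a domination of random-cluster measures in their edge parameters.  (This is the `q = 1` pointwise coupling of prim-hp-8's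
`CSH.phiIntegrand_mono`, re-organised so that the world sample of the larger cluster is drawn AFTER the world sample of the smaller one —
which supplies the simultaneous domination a static coupling lacks for `q > 1`.)

This file: `FK.rcE` (sum-level expectation), `FK.setW` (reveal a pair), `FK.popen` (`φ_v(f open)`), `FK.oneSet` (surely-open pairs),
`FK.undet`, `FK.undet3` (potentials of the two inductions), `FK.Gx`, `FK.Xw`, `FK.Th` (`Θ_w`), and their bookkeeping lemmas.
[cite: Grimmett2006, §1.4 eq. (1.20) (p. 15); Thm. (3.7) (p. 39); Thm. (3.21) (p. 44)] [cite: VandenbergHaggstromKahn2005, §2.1 Lemmas 2.3–2.4 (p. 10), pp. 10–12]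
-/

noncomputable section

namespace Summit.CriticalPhenomena.PercolationContinuityZ3.Theorems

open MeasureTheory Set Literature.Probability.LatticeModels Literature.Probability.Percolation
open scoped Classical
open BHK2006 DecisionTree HullPort

namespace FK

variable {V : Type*} [Fintype V]

/-- `E_v[h] = Σ_ω φ_v(ω) h(ω)`: expectation under the free random-cluster measure with edge parameters `v` (sum level).
[cite: Grimmett2006, §1.4 eq. (1.20) (p. 15)] -/
def rcE (v : Sym2 V → unitInterval) (q : ℝ) (h : BondConfig V → ℝ) : ℝ := ∑ ω, rcMass v q ω * h ω

/-- **Revealing a pair**: `v[f ↦ 1]` (`b = true`, the pair is open / contracted) or `v[f ↦ 0]` (`b = false`, closed / deleted).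
[cite: Grimmett2006, Thm. (3.7) (p. 39)] -/
def setW (v : Sym2 V → unitInterval) (f : Sym2 V) (b : Bool) : Sym2 V → unitInterval :=
  Function.update v f (if b then 1 else 0)

/-- `φ_v(f open)`. [cite: Grimmett2006, Thm. (3.1)(a) (p. 37)] -/
def popen (v : Sym2 V → unitInterval) (q : ℝ) (f : Sym2 V) : ℝ := rcE v q (ind {ω : BondConfig V | f ∈ ω})

/-- The pairs of parameter exactly `1` (surely open), as a configuration. [folklore] -/
def oneSet (v : Sym2 V → unitInterval) : BondConfig V := {f | v f = 1}

/-- The UNDETERMINED pairs of `v` (parameter strictly between `0` and `1`) — the potential of the exploration inductions. [folklore] -/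
def undet (v : Sym2 V → unitInterval) : Finset (Sym2 V) := Finset.univ.filter fun f => ¬ (v f = 0 ∨ v f = 1)

/-- Membership in `undet`. [folklore] -/
theorem mem_undet_iff (v : Sym2 V → unitInterval) (f : Sym2 V) : f ∈ undet v ↔ ¬ (v f = 0 ∨ v f = 1) := by
  simp [undet]

omit [Fintype V] in
/-- `setW` at the revealed pair. [folklore] -/
@[simp] theorem setW_self (v : Sym2 V → unitInterval) (f : Sym2 V) (b : Bool) :
    setW v f b f = (if b then 1 else 0) := by
  simp [setW]

omit [Fintype V] in
/-- `setW` elsewhere. [folklore] -/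
theorem setW_ne (v : Sym2 V → unitInterval) {f e : Sym2 V} (h : e ≠ f) (b : Bool) : setW v f b e = v e := by
  simp [setW, Function.update_of_ne h]

omit [Fintype V] in
/-- The revealed pair is determined. [folklore] -/
theorem setW_self_det (v : Sym2 V → unitInterval) (f : Sym2 V) (b : Bool) : setW v f b f = 0 ∨ setW v f b f = 1 := by
  rw [setW_self]; cases b <;> simp

/-- Revealing an undetermined pair lowers the potential: `undet (v[f↦b]) ⊆ (undet v).erase f`. [folklore] -/
theorem undet_setW_subset (v : Sym2 V → unitInterval) (f : Sym2 V) (b : Bool) : undet (setW v f b) ⊆ (undet v).erase f := by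
  intro e he
  rw [mem_undet_iff] at he
  rw [Finset.mem_erase, mem_undet_iff]
  by_cases h : e = f
  · subst h; exact absurd (setW_self_det v e b) he
  · rw [setW_ne v h] at he; exact ⟨h, he⟩

/-- Hence `card (undet (v[f↦b])) ≤ card (undet v) - 1` when `f` was undetermined. [folklore] -/
theorem card_undet_setW_le (v : Sym2 V → unitInterval) {f : Sym2 V} (hf : f ∈ undet v) (b : Bool) :
    (undet (setW v f b)).card ≤ (undet v).card - 1 := by
  have h := Finset.card_le_card (undet_setW_subset v f b)
  rw [Finset.card_erase_of_mem hf] at h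
  exact h

/-- Revealing any pair does not raise the potential. [folklore] -/
theorem card_undet_setW_le' (v : Sym2 V → unitInterval) (f : Sym2 V) (b : Bool) :
    (undet (setW v f b)).card ≤ (undet v).card :=
  (Finset.card_le_card (undet_setW_subset v f b)).trans (Finset.card_le_card (Finset.erase_subset f _))

omit [Fintype V] in
/-- Lockstep order of revealed parameters: `v ≤ v'` and `b₁ ≤ b₂` give `v[f↦b₁] ≤ v'[f↦b₂]`. [folklore] -/
theorem setW_le_setW {v v' : Sym2 V → unitInterval} (hvv : ∀ e, v e ≤ v' e) (f : Sym2 V) {b₁ b₂ : Bool}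
    (hb : b₁ = true → b₂ = true) (e : Sym2 V) : setW v f b₁ e ≤ setW v' f b₂ e := by
  by_cases h : e = f
  · subst h
    rw [setW_self, setW_self]
    cases b₁ <;> cases b₂ <;> simp_all
  · rw [setW_ne v h, setW_ne v' h]; exact hvv e

omit [Fintype V] in
/-- `oneSet (v[f↦1]) = insert f (oneSet v)`. [folklore] -/
theorem oneSet_setW_true (v : Sym2 V → unitInterval) (f : Sym2 V) : oneSet (setW v f true) = insert f (oneSet v) := by
  ext e
  simp only [oneSet, mem_setOf_eq, mem_insert_iff]
  by_cases h : e = f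
  · subst h; simp [setW_self]
  · rw [setW_ne v h]; simp [h]

omit [Fintype V] in
/-- `oneSet (v[f↦0]) = oneSet v` when `v f ≠ 1`. [folklore] -/
theorem oneSet_setW_false (v : Sym2 V → unitInterval) {f : Sym2 V} (hf : v f ≠ 1) : oneSet (setW v f false) = oneSet v := by
  ext e
  simp only [oneSet, mem_setOf_eq]
  by_cases h : e = f
  · subst h; simp [setW_self, hf]
  · rw [setW_ne v h]

omit [Fintype V] in
/-- `oneSet` is monotone in the parameters. [folklore] -/
theorem oneSet_mono {v v' : Sym2 V → unitInterval} (hvv : ∀ e, v e ≤ v' e) : oneSet v ⊆ oneSet v' := by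
  intro e he
  simp only [oneSet, mem_setOf_eq] at he ⊢
  exact le_antisymm (unitInterval.le_one _) (he ▸ hvv e)

omit [Fintype V] in
/-- `oneSet v ⊆ oneSet (v[f ↦ b])` when `v f ≠ 1`. [folklore] -/
theorem oneSet_subset_oneSet_setW (v : Sym2 V → unitInterval) {f : Sym2 V} (hf : v f ≠ 1) (b : Bool) :
    oneSet v ⊆ oneSet (setW v f b) := by
  cases b
  · rw [oneSet_setW_false v hf]
  · rw [oneSet_setW_true]; exact subset_insert _ _

/-- The pairs not determined in all three of `a`, `b`, `c` — the potential of the phase-2 induction. [folklore] -/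
def undet3 (a b c : Sym2 V → unitInterval) : Finset (Sym2 V) :=
  Finset.univ.filter fun f => ¬ ((a f = 0 ∨ a f = 1) ∧ (b f = 0 ∨ b f = 1) ∧ (c f = 0 ∨ c f = 1))

/-- Membership in `undet3`. [folklore] -/
theorem mem_undet3_iff (a b c : Sym2 V → unitInterval) (f : Sym2 V) :
    f ∈ undet3 a b c ↔ ¬ ((a f = 0 ∨ a f = 1) ∧ (b f = 0 ∨ b f = 1) ∧ (c f = 0 ∨ c f = 1)) := by
  simp [undet3]

/-- Revealing `f` in all three vectors removes it from the potential. [folklore] -/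
theorem undet3_setW_subset (a b c : Sym2 V → unitInterval) (f : Sym2 V) (b₁ b₂ b₃ : Bool) :
    undet3 (setW a f b₁) (setW b f b₂) (setW c f b₃) ⊆ (undet3 a b c).erase f := by
  intro e he
  rw [mem_undet3_iff] at he
  rw [Finset.mem_erase, mem_undet3_iff]
  by_cases h : e = f
  · subst h; exact absurd ⟨setW_self_det a e b₁, setW_self_det b e b₂, setW_self_det c e b₃⟩ he
  · rw [setW_ne a h, setW_ne b h, setW_ne c h] at he; exact ⟨h, he⟩

/-- `g(C_x(ω))` as a function of the configuration. [folklore] -/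
def Gx (g : Set (Sym2 V) → ℝ) (x : V) : BondConfig V → ℝ := fun ω => g (openEdgeCluster ω x)

omit [Fintype V] in
/-- `Gx g x` is monotone for monotone `g`. [cite: VandenbergHaggstromKahn2005, §1 p. 3] -/
theorem Gx_mono {g : Set (Sym2 V) → ℝ} (hg : Monotone g) (x : V) : Monotone (Gx g x) :=
  fun _ _ h => hg (openEdgeCluster_mono h x)

/-- **The integrand `X_w`**: `X_w(ω) = 1{x ↮ Y}(ω)·(a_w(C_Y(ω)) − g(C_x(ω)))` with the world mean
`a_w(W) = E_{φ_{w − W̄}} g(C_x)` taken in the WORLD parameters `w`. [cite: VandenbergHaggstromKahn2005, §2.1 Lemma 2.3 (p. 10)] -/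
def Xw (w : Sym2 V → unitInterval) (q : ℝ) (x : V) (Y : Set V) (g : Set (Sym2 V) → ℝ) : BondConfig V → ℝ :=
  fun ω => ind (avoidEv x Y) ω * (rcE (delW w (cut Y ω)) q (Gx g x) - Gx g x ω)

/-- **`Θ_w(v) = E_{φ_v}[X_w]`** — `FK.phiFK` with the measure parameter `v` decoupled from the world parameter `w`.
[cite: VandenbergHaggstromKahn2005, §2.1 Lemmas 2.3–2.4 (p. 10)] -/
def Th (w : Sym2 V → unitInterval) (q : ℝ) (x : V) (Y : Set V) (g : Set (Sym2 V) → ℝ) (v : Sym2 V → unitInterval) : ℝ :=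
  rcE v q (Xw w q x Y g)

end FK

end Summit.CriticalPhenomena.PercolationContinuityZ3.Theorems

end
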